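import Summits.CriticalPhenomena.CardyFormulaZ2.Theorems.CardyComplexConeDefs
import Literature.Probability.Percolation.BondPercolationSymmetry
import Literature.Probability.LatticeModels.PlanarIsingMeshTranslate

/-!
# Translation covariance of the medial exploration path (sub-goal `medialExploration_shiftData`)

Line `qkz-strip-boundary-arm` of the crux `EdgePrecompact` (item stmt-CriticalPhenomena-11387),
registered sub-goal `medialExploration_shiftData` (part A of `stub_translationCovariance`): exploring
the translated Dobrushin data `shiftData E w` in the translated configuration `ω + w` gives the
translated path. Pure transport of structure: the lattice translation `x ↦ x + w` carries corners,
`cornerSource`/`cornerTarget`, inner faces, the square-lattice boundary, the discrete arcs (the metric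
comparison is invariant under the isometry `z ↦ z + δw`), the `A`–`B` edges, `bcBondConfig` and the
dual configuration, hence the predicate `IsMedialExploration`, to their translates
(`isMedialExploration_shiftData_map`, `isMedialExploration_shiftData_iff`); translation being a
bijection of lists, unique existence and the chosen path are transported too (no admissibility
needed: without a unique exploration both sides are the junk value `[]`).
References: S. Smirnov, C. R. Acad. Sci. Paris 333 (2001), §2 (the exploration path); G. Grimmett,
*Percolation*, 2nd ed. (1999), §1.6 (translation invariance).
-/

namespace Summit.CriticalPhenomena.CardyFormulaZ2.Cruxes.EdgePrecompact.QkzStripBoundaryArm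

open MeasureTheory Filter Set Metric
open scoped Topology BigOperators Pointwise
open Literature.Probability.LatticeModels Literature.Probability.Percolation
open Literature.Probability.RandomPlanarGeometry (DobrushinDomain)
open Summit.CriticalPhenomena.CardyFormulaZ2.Theses.CardyComplexCone

/-! ## Translations acting on sites, corners, medial vertices and configurations -/

section Sites

variable (v f w : Site 2)

/-- Every site is a translate by `w`. -/
theorem exists_add_eq_site (x : Site 2) : ∃ y, y + w = x := ⟨x - w, sub_add_cancel x w⟩

/-- Being a corner of a face is translation invariant. -/
theorem isCorner_add_iff : IsCorner (v + w) (f + w) ↔ IsCorner v f := by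
  refine forall_congr' fun i => ?_
  simp only [Pi.add_apply]
  omega

/-- `cornerNeighbor` commutes with translations. -/
theorem cornerNeighbor_add (i : Fin 2) :
    cornerNeighbor (v + w) (f + w) i = cornerNeighbor v f i + w := by
  ext j
  by_cases hj : j = i
  · subst hj
    simp only [cornerNeighbor, Function.update_self, Pi.add_apply]
    ring
  · simp only [cornerNeighbor, Function.update_of_ne hj, Pi.add_apply]

/-- `cornerEdge` commutes with translations. -/
theorem cornerEdge_add (i : Fin 2) :
    cornerEdge (v + w) (f + w) i = sym2Equiv (Site.shift w) (cornerEdge v f i) := by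
  rw [cornerEdge, cornerEdge, cornerNeighbor_add, sym2Equiv_mk, Site.shift_apply, Site.shift_apply]

/-- The diagonal test orienting a corner is translation invariant. -/
theorem diag_add_iff :
    (v + w) 0 - (f + w) 0 = (v + w) 1 - (f + w) 1 ↔ v 0 - f 0 = v 1 - f 1 := by
  simp only [Pi.add_apply]
  omega

/-- `cornerSource` commutes with translations. -/
theorem cornerSource_add :
    cornerSource (v + w) (f + w) = sym2Equiv (Site.shift w) (cornerSource v f) := by
  simp only [cornerSource, diag_add_iff, cornerEdge_add, apply_ite (sym2Equiv (Site.shift w))]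

/-- `cornerTarget` commutes with translations. -/
theorem cornerTarget_add :
    cornerTarget (v + w) (f + w) = sym2Equiv (Site.shift w) (cornerTarget v f) := by
  simp only [cornerTarget, diag_add_iff, cornerEdge_add, apply_ite (sym2Equiv (Site.shift w))]

/-- Translations preserve the edges of `ℤ²`. -/
theorem shift_mem_edgeSet_iff (e : Sym2 (Site 2)) :
    sym2Equiv (Site.shift w) e ∈ (zdGraph 2).edgeSet ↔ e ∈ (zdGraph 2).edgeSet :=
  sym2Equiv_mem_edgeSet_iff (G := zdGraph 2) (G' := zdGraph 2)
    { toEquiv := Site.shift w, map_rel_iff' := fun {a b} => zdGraph_adj_shift_iff w a b } e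

/-- `dualEdge` commutes with translations (for all pairs: `⊔`, `⊓` and the case test are
translation covariant). -/
theorem dualEdge_shift (e : Sym2 (Site 2)) :
    dualEdge (sym2Equiv (Site.shift w) e) = sym2Equiv (Site.shift w) (dualEdge e) := by
  induction e using Sym2.ind with
  | h x y =>
    rw [sym2Equiv_mk, Site.shift_apply, Site.shift_apply]
    simp only [dualEdge, Sym2.lift_mk, ← sup_add, ← inf_add, add_right_comm _ w, add_left_inj]
    split_ifs <;> simp only [sym2Equiv_mk, Site.shift_apply, add_sub_right_comm]

/-- `e2 z ∈ e2 '' ω ↔ z ∈ ω`. -/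
theorem apply_mem_relabel_iff {V W : Type*} (e2 : Sym2 V ≃ Sym2 W) (ω : BondConfig V)
    (z : Sym2 V) : e2 z ∈ BondConfig.relabel e2 ω ↔ z ∈ ω := by
  rw [BondConfig.mem_relabel_iff, Equiv.symm_apply_apply]

/-- Relabelling back and forth is the identity. -/
theorem relabel_symm_relabel_eq {V W : Type*} (e2 : Sym2 V ≃ Sym2 W) (ω : BondConfig V) :
    BondConfig.relabel e2.symm (BondConfig.relabel e2 ω) = ω := by
  ext z
  rw [BondConfig.mem_relabel_iff, Equiv.symm_symm, apply_mem_relabel_iff]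

/-- The dual configuration of a translated configuration is the translated dual configuration. -/
theorem dualConfig_relabel_shift_eq (ω : BondConfig (Site 2)) :
    dualConfig (BondConfig.relabel (sym2Equiv (Site.shift w)) ω) =
      BondConfig.relabel (sym2Equiv (Site.shift w)) (dualConfig ω) := by
  rw [BondConfig.relabel_apply, BondConfig.relabel_apply, dualConfig, dualConfig,
    Set.image_sdiff (sym2Equiv (Site.shift w)).injective, Set.image_image, Set.image_image]
  congr 1
  · ext e
    rw [Set.mem_image_equiv, ← shift_mem_edgeSet_iff w ((sym2Equiv (Site.shift w)).symm e),
      Equiv.apply_symm_apply]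
  · congr 1
    funext e
    exact dualEdge_shift w e

/-- On unordered pairs, translation by `-w` is the inverse of translation by `w`. -/
theorem sym2Equiv_shift_neg : sym2Equiv (Site.shift (-w)) = (sym2Equiv (Site.shift w)).symm := by
  rw [sym2Equiv_symm, show Site.shift (-w) = (Site.shift w).symm from
    Equiv.ext fun x => by simp [sub_eq_add_neg]]

/-- `∀` over the translated pair. -/
theorem forall_mem_shift_iff (e : Sym2 (Site 2)) (P : Site 2 → Prop) :
    (∀ x ∈ sym2Equiv (Site.shift w) e, P x) ↔ ∀ x ∈ e, P (x + w) := by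
  simp [Sym2.mem_map]

/-- `∃` over the translated pair. -/
theorem exists_mem_shift_iff (e : Sym2 (Site 2)) (P : Site 2 → Prop) :
    (∃ x ∈ sym2Equiv (Site.shift w) e, P x) ↔ ∃ x ∈ e, P (x + w) := by
  simp [Sym2.mem_map]

end Sites

/-! ## Plane geometry under the translation `z ↦ δw + z` -/

/-- The mesh point of a translated site is the translate of its mesh point: `δ(x + w) = δw + δx`. -/
theorem meshPoint_add_shift (δ : ℝ) (x w : Site 2) :
    meshPoint δ (x + w) = meshPoint δ w + meshPoint δ x := by
  apply Complex.ext <;> simp [mul_add, add_comm]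

/-- The frontier of a translate is the translated frontier. -/
theorem frontier_vadd_set (u : ℂ) (S : Set ℂ) : frontier (u +ᵥ S) = u +ᵥ frontier S := by
  rw [← closure_sdiff_interior, ← closure_sdiff_interior, closure_vadd, interior_vadd,
    Set.vadd_set_sdiff]

/-- The distance to a set is invariant under a common translation. -/
theorem infDist_add_vadd (u z : ℂ) (S : Set ℂ) : infDist (u + z) (u +ᵥ S) = infDist z S := by
  rw [← vadd_eq_add, Metric.infDist, Metric.infDist, Metric.infEDist_vadd]

/-! ## The translated Dobrushin data -/

section Data

variable (E : DiscreteDobrushin) (w : Site 2)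

/-- The domain of the translated data. -/
@[simp] theorem shiftData_Ω : (shiftData E w).Ω = meshPoint E.δ w +ᵥ E.Ω := rfl

/-- The mesh of the translated data. -/
@[simp] theorem shiftData_δ : (shiftData E w).δ = E.δ := rfl

/-- Translating by `w` and back restores the data. -/
theorem shiftData_neg_shiftData : shiftData (shiftData E w) (-w) = E := by
  simpa only [neg_neg] using shiftData_shiftData_neg E (-w)

/-- The graph `Ω_δ` of the translated data is the translated graph. -/
theorem adj_shiftData_iff (x y : Site 2) :
    (discreteDomainGraph (shiftData E w).Ω (shiftData E w).δ).Adj (x + w) (y + w) ↔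
      (discreteDomainGraph E.Ω E.δ).Adj x y := by
  rw [shiftData_Ω, shiftData_δ, discreteDomainGraph_adj_vadd, add_sub_cancel_right,
    add_sub_cancel_right]

/-- Inner faces of the translated data are the translated inner faces. -/
theorem isInnerFace_shiftData_iff (f : Site 2) :
    (shiftData E w).IsInnerFace (f + w) ↔ E.IsInnerFace f := by
  constructor
  · intro h v v' hv hv' hadj
    rw [← adj_shiftData_iff E w]
    exact h _ _ ((isCorner_add_iff v f w).2 hv) ((isCorner_add_iff v' f w).2 hv')
      ((zdGraph_adj_shift_iff w v v').2 hadj)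
  · intro h v₁ v₂ hv₁ hv₂ hadj
    obtain ⟨v, rfl⟩ := exists_add_eq_site w v₁
    obtain ⟨v', rfl⟩ := exists_add_eq_site w v₂
    rw [adj_shiftData_iff]
    exact h _ _ ((isCorner_add_iff v f w).1 hv₁) ((isCorner_add_iff v' f w).1 hv₂)
      ((zdGraph_adj_shift_iff w v v').1 hadj)

/-- Face-boundary edges of the translated data are the translated ones. -/
theorem isFaceBoundaryEdge_shiftData_iff (x y : Site 2) :
    (shiftData E w).IsFaceBoundaryEdge (x + w) (y + w) ↔ E.IsFaceBoundaryEdge x y := by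
  constructor
  · rintro ⟨hadj, ⟨f₁, hf, hx, hy⟩, g₁, hg, hx', hy'⟩
    obtain ⟨f, rfl⟩ := exists_add_eq_site w f₁
    obtain ⟨g, rfl⟩ := exists_add_eq_site w g₁
    rw [isInnerFace_shiftData_iff] at hf hg
    rw [isCorner_add_iff] at hx hy hx' hy'
    exact ⟨(adj_shiftData_iff E w x y).1 hadj, ⟨f, hf, hx, hy⟩, g, hg, hx', hy'⟩
  · rintro ⟨hadj, ⟨f, hf, hx, hy⟩, g, hg, hx', hy'⟩
    exact ⟨(adj_shiftData_iff E w x y).2 hadj, ⟨f + w, (isInnerFace_shiftData_iff E w f).2 hf,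
      (isCorner_add_iff x f w).2 hx, (isCorner_add_iff y f w).2 hy⟩, g + w,
      fun h => hg ((isInnerFace_shiftData_iff E w g).1 h), (isCorner_add_iff x g w).2 hx',
      (isCorner_add_iff y g w).2 hy'⟩

/-- The square-lattice boundary of the translated data is the translated boundary. -/
theorem mem_zdBoundary_shiftData_iff (x : Site 2) :
    x + w ∈ (shiftData E w).zdBoundary ↔ x ∈ E.zdBoundary := by
  rw [DiscreteDobrushin.mem_zdBoundary_iff, DiscreteDobrushin.mem_zdBoundary_iff, shiftData_Ω,
    shiftData_δ, mem_meshBoundary_vadd, add_sub_cancel_right]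
  refine or_congr_right ⟨?_, ?_⟩
  · rintro ⟨y₁, hy⟩
    obtain ⟨y, rfl⟩ := exists_add_eq_site w y₁
    exact ⟨y, (isFaceBoundaryEdge_shiftData_iff E w x y).1 hy⟩
  · rintro ⟨y, hy⟩
    exact ⟨y + w, (isFaceBoundaryEdge_shiftData_iff E w x y).2 hy⟩

/-- Discrete arcs of the translated data (and translated arc) are the translated discrete arcs:
the metric comparison is invariant under the isometry `z ↦ δw + z`. -/
theorem mem_zdDiscreteArc_shiftData_iff (A' : Set ℂ) (x : Site 2) :
    x + w ∈ (shiftData E w).zdDiscreteArc (meshPoint E.δ w +ᵥ A') ↔ x ∈ E.zdDiscreteArc A' := by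
  rw [DiscreteDobrushin.mem_zdDiscreteArc_iff, DiscreteDobrushin.mem_zdDiscreteArc_iff,
    mem_zdBoundary_shiftData_iff, shiftData_δ, shiftData_Ω, frontier_vadd_set,
    ← Set.vadd_set_sdiff, meshPoint_add_shift, infDist_add_vadd, infDist_add_vadd]

/-- The discrete arc of `A` of the translated data is the translated one. -/
theorem mem_zdArcA_shiftData_iff (x : Site 2) : x + w ∈ (shiftData E w).zdArcA ↔ x ∈ E.zdArcA :=
  mem_zdDiscreteArc_shiftData_iff E w E.arcA x

/-- The discrete arc of `B` of the translated data is the translated one. -/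
theorem mem_zdArcB_shiftData_iff (x : Site 2) : x + w ∈ (shiftData E w).zdArcB ↔ x ∈ E.zdArcB :=
  mem_zdDiscreteArc_shiftData_iff E w E.arcB x

/-- The edges of `Ω_δ` of the translated data are the translated edges. -/
theorem shift_mem_edgeSet_shiftData_iff (e : Sym2 (Site 2)) :
    sym2Equiv (Site.shift w) e ∈ (discreteDomainGraph (shiftData E w).Ω (shiftData E w).δ).edgeSet ↔
      e ∈ (discreteDomainGraph E.Ω E.δ).edgeSet := by
  induction e using Sym2.ind with
  | h x y =>
    rw [sym2Equiv_mk, Site.shift_apply, Site.shift_apply, SimpleGraph.mem_edgeSet,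
      SimpleGraph.mem_edgeSet, adj_shiftData_iff]

/-- The `A`–`B` edges of the translated data are the translated `A`–`B` edges. -/
theorem shift_mem_zdABEdges_iff (e : Sym2 (Site 2)) :
    sym2Equiv (Site.shift w) e ∈ (shiftData E w).zdABEdges ↔ e ∈ E.zdABEdges := by
  rw [DiscreteDobrushin.mem_zdABEdges_iff, DiscreteDobrushin.mem_zdABEdges_iff,
    shift_mem_edgeSet_shiftData_iff, exists_mem_shift_iff, exists_mem_shift_iff]
  simp only [mem_zdArcA_shiftData_iff, mem_zdArcB_shiftData_iff]

/-- Imposing the boundary conditions commutes with translating data and configuration. -/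
theorem bcBondConfig_shiftData (ω : BondConfig (Site 2)) :
    (shiftData E w).bcBondConfig (BondConfig.relabel (sym2Equiv (Site.shift w)) ω) =
      BondConfig.relabel (sym2Equiv (Site.shift w)) (E.bcBondConfig ω) := by
  ext e₁
  obtain ⟨e, rfl⟩ := (sym2Equiv (Site.shift w)).surjective e₁
  rw [apply_mem_relabel_iff, DiscreteDobrushin.mem_bcBondConfig_iff,
    DiscreteDobrushin.mem_bcBondConfig_iff, shift_mem_edgeSet_shiftData_iff, apply_mem_relabel_iff,
    forall_mem_shift_iff, forall_mem_shift_iff]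
  simp only [mem_zdArcA_shiftData_iff, mem_zdArcB_shiftData_iff]

/-- Medial steps of the translated data are the translated medial steps. -/
theorem isMedialStep_shiftData_iff (e e' : MedialVertex) :
    (shiftData E w).IsMedialStep (sym2Equiv (Site.shift w) e) (sym2Equiv (Site.shift w) e') ↔
      E.IsMedialStep e e' := by
  constructor
  · rintro ⟨v₁, f₁, hc, hf, hs, ht⟩
    obtain ⟨v, rfl⟩ := exists_add_eq_site w v₁
    obtain ⟨f, rfl⟩ := exists_add_eq_site w f₁
    rw [cornerSource_add] at hs
    rw [cornerTarget_add] at ht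
    exact ⟨v, f, (isCorner_add_iff v f w).1 hc, (isInnerFace_shiftData_iff E w f).1 hf,
      (sym2Equiv _).injective hs, (sym2Equiv _).injective ht⟩
  · rintro ⟨v, f, hc, hf, rfl, rfl⟩
    exact ⟨v + w, f + w, (isCorner_add_iff v f w).2 hc, (isInnerFace_shiftData_iff E w f).2 hf,
      cornerSource_add v f w, cornerTarget_add v f w⟩

/-- The turning rule is translation covariant. -/
theorem isMedialTurn_relabel_iff (ω : BondConfig (Site 2)) (e₀ e₁ e₂ : MedialVertex) :
    IsMedialTurn (BondConfig.relabel (sym2Equiv (Site.shift w)) ω) (sym2Equiv (Site.shift w) e₀)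
      (sym2Equiv (Site.shift w) e₁) (sym2Equiv (Site.shift w) e₂) ↔ IsMedialTurn ω e₀ e₁ e₂ := by
  have key : dualEdge (sym2Equiv (Site.shift w) e₁) ∈
      dualConfig (BondConfig.relabel (sym2Equiv (Site.shift w)) ω) ↔ dualEdge e₁ ∈ dualConfig ω := by
    rw [dualEdge_shift, dualConfig_relabel_shift_eq, apply_mem_relabel_iff]
  have inj := (sym2Equiv (Site.shift w)).injective
  constructor
  · rintro ⟨v₁', f₁', v₂', f₂', hc₁, hs₁, ht₁, hc₂, hs₂, ht₂, hlast⟩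
    obtain ⟨v₁, rfl⟩ := exists_add_eq_site w v₁'
    obtain ⟨f₁, rfl⟩ := exists_add_eq_site w f₁'
    obtain ⟨v₂, rfl⟩ := exists_add_eq_site w v₂'
    obtain ⟨f₂, rfl⟩ := exists_add_eq_site w f₂'
    rw [cornerSource_add] at hs₁ hs₂
    rw [cornerTarget_add] at ht₁ ht₂
    rw [isCorner_add_iff] at hc₁ hc₂
    rw [add_left_inj, add_left_inj, key, apply_mem_relabel_iff] at hlast
    exact ⟨v₁, f₁, v₂, f₂, hc₁, inj hs₁, inj ht₁, hc₂, inj hs₂, inj ht₂, hlast⟩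
  · rintro ⟨v₁, f₁, v₂, f₂, hc₁, rfl, rfl, hc₂, hs₂, rfl, hlast⟩
    refine ⟨v₁ + w, f₁ + w, v₂ + w, f₂ + w, (isCorner_add_iff _ _ _).2 hc₁, cornerSource_add _ _ _,
      cornerTarget_add _ _ _, (isCorner_add_iff _ _ _).2 hc₂, by rw [cornerSource_add, hs₂],
      cornerTarget_add _ _ _, ?_⟩
    rwa [add_left_inj, add_left_inj, key, apply_mem_relabel_iff]

end Data

/-! ## Transport of the exploration predicate and of the chosen path -/

/-- **Transport of structure.** The translate of an exploration path of `ω` in `E` is an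
exploration path of `ω + w` in the translated data. -/
theorem isMedialExploration_shiftData_map {E : DiscreteDobrushin} {ω : BondConfig (Site 2)}
    {γ : List MedialVertex} (h : IsMedialExploration E ω γ) (w : Site 2) :
    IsMedialExploration (shiftData E w) (BondConfig.relabel (sym2Equiv (Site.shift w)) ω)
      (γ.map (sym2Equiv (Site.shift w))) := by
  have hback : ∀ l : List MedialVertex,
      (l.map (sym2Equiv (Site.shift w))).map (sym2Equiv (Site.shift w)).symm = l := fun l => by
    rw [List.map_map, Equiv.symm_comp_self, List.map_id]
  have hne : γ.map (sym2Equiv (Site.shift w)) ≠ [] := by simpa using h.ne_nil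
  refine ⟨hne, ?_, ?_, ?_, ?_, ?_, ?_, ?_⟩
  · intro e e' hinf
    have h2 := hinf.map (sym2Equiv (Site.shift w)).symm
    rw [hback] at h2
    have := (isMedialStep_shiftData_iff E w _ _).2 (h.step _ _ h2)
    simpa only [Equiv.apply_symm_apply] using this
  · intro e₀ e₁ e₂ hinf
    have h2 := hinf.map (sym2Equiv (Site.shift w)).symm
    rw [hback] at h2
    have := (isMedialTurn_relabel_iff w (E.bcBondConfig ω) _ _ _).2 (h.turn _ _ _ h2)
    rw [← bcBondConfig_shiftData] at this
    simpa only [Equiv.apply_symm_apply] using this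
  · rw [← List.map_tail, List.zip_map]
    exact h.nodup.map ((sym2Equiv _).injective.prodMap (sym2Equiv _).injective)
  · rw [List.head_map]
    exact (shift_mem_zdABEdges_iff E w _).2 h.head_mem
  · rw [List.getLast_map]
    exact (shift_mem_zdABEdges_iff E w _).2 h.getLast_mem
  · rw [List.head_map, List.getLast_map]
    exact fun heq => h.head_ne_getLast ((sym2Equiv _).injective heq)
  · intro e e' hpre
    have h2 := hpre.map (sym2Equiv (Site.shift w)).symm
    rw [hback] at h2
    obtain ⟨v, f, hc, hs, ht, hA⟩ := h.start _ _ h2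
    refine ⟨v + w, f + w, (isCorner_add_iff v f w).2 hc, ?_, ?_, (mem_zdArcA_shiftData_iff E w v).2 hA⟩
    · rw [cornerSource_add, hs]; exact Equiv.apply_symm_apply _ _
    · rw [cornerTarget_add, ht]; exact Equiv.apply_symm_apply _ _

/-- **Transport of the predicate, as an equivalence**: `γ'` is an exploration of `ω + w` in the
translated data iff `γ' - w` is an exploration of `ω` in `E` (the converse direction is the
forward one for the translation by `-w`). -/
theorem isMedialExploration_shiftData_iff (E : DiscreteDobrushin) (w : Site 2)
    (ω : BondConfig (Site 2)) (γ' : List MedialVertex) :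
    IsMedialExploration (shiftData E w) (BondConfig.relabel (sym2Equiv (Site.shift w)) ω) γ' ↔
      IsMedialExploration E ω (γ'.map (sym2Equiv (Site.shift w)).symm) := by
  constructor
  · intro h
    have h2 := isMedialExploration_shiftData_map h (-w)
    rwa [shiftData_neg_shiftData, sym2Equiv_shift_neg, relabel_symm_relabel_eq] at h2
  · intro h
    have h2 := isMedialExploration_shiftData_map h w
    rwa [List.map_map, Equiv.self_comp_symm, List.map_id] at h2

/-- With a unique exploration path, `medialExploration` is that path. -/
theorem medialExploration_eq_of_existsUnique {D : DiscreteDobrushin} {ω : BondConfig (Site 2)}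
    {γ : List MedialVertex} (h : ∃! γ, IsMedialExploration D ω γ) (hγ : IsMedialExploration D ω γ) :
    medialExploration D ω = γ := by
  classical
  unfold medialExploration
  rw [dif_pos h]
  exact h.unique h.exists.choose_spec hγ

/-- Without a unique exploration path, `medialExploration` is the junk value `[]`. -/
theorem medialExploration_eq_nil {D : DiscreteDobrushin} {ω : BondConfig (Site 2)}
    (h : ¬ ∃! γ, IsMedialExploration D ω γ) : medialExploration D ω = [] := by
  classical
  unfold medialExploration
  rw [dif_neg h]

/-- **Translation covariance of the medial exploration path** (registered sub-goal
`medialExploration_shiftData`, part A of `stub_translationCovariance`): exploring the translated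
data in the translated configuration gives the translated path. (Smirnov 2001, §2; Grimmett 1999,
§1.6.) -/
theorem medialExploration_shiftData : ∀ (E : DiscreteDobrushin) (w : Site 2) (ω : BondConfig (Site 2)),
    medialExploration (shiftData E w) (BondConfig.relabel (sym2Equiv (Site.shift w)) ω) =
    (medialExploration E ω).map (sym2Equiv (Site.shift w)) := by
  intro E w ω
  by_cases h : ∃! γ, IsMedialExploration E ω γ
  · obtain ⟨γ, hγ, huniq⟩ := id h
    have h' : ∃! γ', IsMedialExploration (shiftData E w)
        (BondConfig.relabel (sym2Equiv (Site.shift w)) ω) γ' := by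
      refine ⟨_, isMedialExploration_shiftData_map hγ w, fun γ' hγ' => ?_⟩
      rw [← huniq _ ((isMedialExploration_shiftData_iff E w ω γ').1 hγ'), List.map_map,
        Equiv.self_comp_symm, List.map_id]
    rw [medialExploration_eq_of_existsUnique h' (isMedialExploration_shiftData_map hγ w),
      medialExploration_eq_of_existsUnique h hγ]
  · have h' : ¬ ∃! γ', IsMedialExploration (shiftData E w)
        (BondConfig.relabel (sym2Equiv (Site.shift w)) ω) γ' := by
      rintro ⟨γ', hγ', huniq⟩
      refine h ⟨_, (isMedialExploration_shiftData_iff E w ω γ').1 hγ', fun γ hγ => ?_⟩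
      rw [← huniq _ (isMedialExploration_shiftData_map hγ w), List.map_map, Equiv.symm_comp_self, List.map_id]
    rw [medialExploration_eq_nil h', medialExploration_eq_nil h, List.map_nil]

end Summit.CriticalPhenomena.CardyFormulaZ2.Cruxes.EdgePrecompact.QkzStripBoundaryArm
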